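import Mathlib
import HarnessLib
import Literature.AlgebraicGeometry.HodgeTheory.WeilClassesBFSheafSeedAt
import Literature.AlgebraicGeometry.HodgeTheory.WeilClassesFourfolds
import Literature.AlgebraicGeometry.HodgeTheory.ChernCharacterBettiSums
import Literature.AlgebraicGeometry.ModuliOfSheaves.MuStability

/-!
# Split pure-Weil seeds need a `K`-antisymmetric root — and (granted THEOREM S) do not exist

HONEST FRAMING. A NEGATIVE lemma about ONE population of candidate objects for the registered first rung
`stub_rung_CMclass_d3 : KleimanAnchorRungCM 3` of the skeleton
`Cruxes/TwistNormalisedKleimanSemiregularAnchor/Lines/chosen_anchor.lean` (crux K2ᵀ, stmt-HodgeConjecture-28148,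
route `KleimanBFSeeds`): direct sums of rank-`≤ 1` sheaves ("split designs"). It says NOTHING about the truth of
the rung, of K2ᵀ, of `WeilSixfolds`, HC_AV, HC_CM or HC, and it constructs no sheaf. The rung's proved reduction
`kleimanAnchorRungCM_of_pureWeilSeedOnTwistedSquare` asks for a PURE-WEIL semiregular seed: by
`Theorems.forall_models_pureWeilSeed_iff_exists_on` (p814302) this is ONE finite locally free `E₀` on `P.X`
(`P = T × T` a twisted square), an index set `I ∋ 3`, `σ_{I−1}` jointly injective, `C.ch₃ E₀ = N·w` (`N ≠ 0`,
`w` in the Weil plane) and `C.chₚ E₀ = 0` for `p ∈ I ∖ 3`.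

WHAT IS PROVED HERE, UNCONDITIONALLY, on the tree's real carriers (§1–§3):

* §1 `eq_zero_of_map_eq_pow_smul_of_mem_weilClassesOf`: on a complex abelian variety `P` with `φ : P ⟶ P`,
  for `n` ODD and `d ≥ 1`, a class `c ∈ H²ⁿ(P(ℂ); ℂ)` with `φ^* c = dⁿ·c` which lies in the Weil plane
  `weilClassesOf P φ n d` is `0` — because `φ^*` acts on the Weil plane by `(−d)ⁿ = −dⁿ`
  (`map_eq_smul_of_mem_weilClassesOf`, van Geemen 4.9: `√−d` acts on `⋀^{2n}_K H¹` by `(√−d)^{2n}`), and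
  `dⁿ ≠ −dⁿ` in characteristic `0`.
* §2 `ch_foldr_biprod_map_eq_pow_smul`: for ANY `C : ChernCharacterBetti`, a split design
  `E₀ = L₁ ⊞ (L₂ ⊞ (⋯ ⊞ Z))` of rank-`≤ 1` sheaves all of whose `C`-ROOTS `u_L := C.ch₁ L` are `K`-SYMMETRIC
  (`φ^* u_L = d·u_L` — the condition `φ^*H = dH` of a `K`-compatible polarisation, Deligne (4.4); in the
  exterior-algebra model: `u_L` is `K`-block-diagonal) has `φ^* C.chᵢ(E₀) = dⁱ·C.chᵢ(E₀)` for every `i ≥ 1`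
  (exponential on line bundles `chᵢ(L) = ch₁(L)ⁱ/i!`, Whitney on `⊞`, naturality of cup powers).
* §3 `splitDesign_KSymmetricRoots_weil_eq_zero` (THE KERNEL-CHECKED HALF (S4) OF THEOREM S): hence such a split
  design never carries an odd-weight Weil class: `C.chₙ(E₀) = N·w`, `w ∈ weilClassesOf P φ n d`, `n` odd forces
  `N = 0 ∨ w = 0`. For the rung (`n = 3`, `P = E_ω³ × Ē_ω³` or any twisted square): a split pure-Weil design
  must have at least one root with a non-zero `K`-ANTISYMMETRIC component (`φ^* u ≠ d·u`).

* §5 `splitDesign_KSymmetricRoots_hLine_weil_eq_zero`: the same for the POLARISED (Kleiman) design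
  `C.chₙ(E₀) = q·hⁿ + N·w` at a `K`-symmetric class `h` (`φ^* h = d·h`: every `K`-compatible polarisation; the
  route's `h = d·e^*a + φ^*e^*a`) — the degree-`n` clause of `HasWeilClassDesignAt` / `HasBFSheafSeedAt C n P h w`
  (K2ᵀ, `stub_good`, every `d`, every cell); and `not_exists_splitBFSheafSeedOn_of_theoremS`, the polarised typed
  obstruction (binder = THEOREM S (S1)–(S3) with the polarised Weil tangent space `T_W`).

* §6 `smul_cupPowTwo_eq_zero_of_map_eq_smul_of_mem_weilClassesOf`: no odd power of a `K`-symmetric class lies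
  in the Weil plane (`ℂ·hⁿ ∩ W_K = 0`); at `n = 3` this discharges, for `K`-symmetric `θ`, the last clause of the
  binder `h₄` of `Theorems.HodgeAbelianVarieties.Negative.not_exists_weilSeeds_of_rigidity`.

* §7 `ch_map_eq_pow_smul_of_shortExact`, `design_eigen_hLine_weil_eq_zero`: the eigen-property is closed under extensions of vector
  bundles, so LINE-FILTERED designs with `K`-symmetric roots (hodge-idea-1 THEOREM N′ (b), (d) populations) carry no odd-weight Weil
  class either.

WHAT IS TYPED, NOT PROVED (§4, ONE binder `hS`, no new named fact): THEOREM S, steps (S1)–(S3), of the crux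
workfile `Cruxes/TwistNormalisedKleimanSemiregularAnchor/SPLIT-SEEDS-DEAD-rung1-g0.md` §3 (pen, one page;
concurred ×2: hodge-idea-1 g10 THEOREM N, tribunal J addendum a7): on a Weil-type `(P, φ)`, an `I′`-semiregular
split design whose `C`-character is pure Weil in degree `n` and vanishes in the other `I`-degrees has ALL its
roots `K`-symmetric. Ingredients in print: `σ_q` restricted to a diagonal block `Ext²(L,L) = H²(𝒪)·id_L` of a
split bundle is `η ↦ η ∪ At(L)^q` [cite: BuchweitzFlenner2003, §4 Def. 4.1] (tree: `sigmaHigher_biprod_eq_add`),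
`At(L) = −2πi·c₁(L)` [cite: Atiyah1957, Prop. 12], first-order variation of Hodge
type `κ⌟` [cite: VoisinHodgeI2002, §10.2.3 (Griffiths transversality)] along the Weil family
[cite: vanGeemen1994HodgeAV, Lemma 5.2], and the MATRIX LEMMA
(`κ₊ᵀB` symmetric for all `κ₊ ∈ Mₙ(ℂ)`, `n ≥ 2` ⇒ `B = 0`). None of `κ⌟`, `At(L) ↔ c₁(L)` on `complexBetti`, or
the Dolbeault comparison `H^{q+2}(X, Ω^q) ↔ H^{q,q+2}` is on the tree's carriers today, which is why (S1)–(S3)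
enter as a hypothesis. Granting `hS`, `not_exists_splitPureWeilSeedOn_of_theoremS` concludes: NO split pure-Weil
seed exists at `(C, P, w)` (the one-model clause of the skeleton's `HasPureWeilSeedAt C P w`, restricted to
`E₀ = l.foldr (· ⊞ ·) Z` with rank-`≤ 1` pieces). The population is thereby closed for the rung at every
twisted square and every `d`; the rung's object must be indecomposable-with-impure-summands-forbidden
(workfile §4.7) — not addressed here.

References: [BuchweitzFlenner2003] = arXiv:math/9912245, §4 Def. 4.1, §5 Thm. 5.1; [vanGeemen1994HodgeAV]
LNM 1594, 4.9, Lemma 5.2, 6.12; [Deligne1982HodgeCycles] LNM 900 §4 (4.4); [Atiyah1957]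
Trans. AMS 85, Prop. 12; [Fulton1998] Example 3.2.3, §15.1 (iii); [HatcherAT2002] §3.2.
-/

-- every declaration of this problem lives in `Summit.HodgeConjecture.HodgeConjecture.…` (summit = sub-problem)
set_option linter.dupNamespace false

noncomputable section

open CategoryTheory CategoryTheory.Limits AlgebraicGeometry

namespace Summit.HodgeConjecture.HodgeConjecture.Theorems.TwistNormalisedKleimanSemiregularAnchor.Negative

open Literature.AlgebraicGeometry Literature.AlgebraicGeometry.Motives Literature.AlgebraicGeometry.Modules
open Literature.AlgebraicGeometry.HodgeTheory
open Literature.AlgebraicTopology.SingularHomology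

variable {P : AbelianVariety ℂ} {φ : P ⟶ P}

/-! ### §1 Class level: `dⁿ`-eigenclasses of `φ^*` versus the Weil plane (`n` odd) -/

/-- **Powers of an eigenclass**: `φ^* u = t·u` in `H²` gives `φ^*(uⁱ) = tⁱ·uⁱ` in `H²ⁱ` (pull-back is a ring map,
`(t·u)ⁱ = tⁱ·uⁱ`). [cite: HatcherAT2002, §3.2 Prop. 3.10] -/
theorem map_cupPowTwo_eq_pow_smul_of_map_eq_smul {u : complexBetti P.X 2} {t : ℂ}
    (hu : complexBetti.map φ.hom.hom.hom 2 u = t • u) (i : ℕ) :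
    complexBetti.map φ.hom.hom.hom (2 * i) (cupPowTwo u i) = t ^ i • cupPowTwo u i := by
  rw [complexBetti_map_cupPowTwo', hu, Literature.AlgebraicGeometry.ModuliOfSheaves.cupPowTwo_smul]

/-- **A `dⁿ`-eigenclass of `φ^*` in the Weil plane vanishes, for `n` odd** (`d ≥ 1`): `φ^*` acts on
`weilClassesOf P φ n d = E₊ ⊔ E₋` by `(± i√d)^{2n} = (−d)ⁿ = −dⁿ` (`map_eq_smul_of_mem_weilClassesOf`), so
`dⁿ·c = −dⁿ·c`, `2dⁿ·c = 0`, `c = 0`. (For `n` even the two eigenvalues coincide and the finer `K`-balance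
grading of the exterior algebra is needed; not here.) [cite: vanGeemen1994HodgeAV, 4.9 and proof of Thm. 6.12] -/
theorem eq_zero_of_map_eq_pow_smul_of_mem_weilClassesOf {n d : ℕ} (hn : Odd n) (hd : 0 < d)
    {c : complexBetti P.X (2 * n)} (hc : complexBetti.map φ.hom.hom.hom (2 * n) c = ((d : ℂ) ^ n) • c)
    (hw : c ∈ weilClassesOf P φ n d) : c = 0 := by
  have h1 : complexBetti.map φ.hom.hom.hom (2 * n) c = ((-(d : ℂ)) ^ n) • c :=
    map_eq_smul_of_mem_weilClassesOf hw
  rw [hn.neg_pow, neg_smul, hc] at h1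
  -- `dⁿ·c = -(dⁿ·c)`
  have h2 : (2 : ℂ) • (((d : ℂ) ^ n) • c) = 0 := by
    rw [two_smul]
    exact add_eq_zero_iff_eq_neg.mpr h1
  rw [smul_smul] at h2
  rcases smul_eq_zero.mp h2 with h | h
  · exfalso
    have hd' : (d : ℂ) ≠ 0 := by exact_mod_cast hd.ne'
    exact mul_ne_zero two_ne_zero (pow_ne_zero n hd') h
  · exact h

/-- **Multiples**: if `c = N·w` with `w` in the Weil plane and `φ^* c = dⁿ·c`, `n` odd, then `N·w = 0`, i.e.
`N = 0 ∨ w = 0`. [cite: vanGeemen1994HodgeAV, 4.9] -/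
theorem smul_eq_zero_of_map_eq_pow_smul_of_mem_weilClassesOf {n d : ℕ} (hn : Odd n) (hd : 0 < d)
    {c : complexBetti P.X (2 * n)} (hc : complexBetti.map φ.hom.hom.hom (2 * n) c = ((d : ℂ) ^ n) • c)
    {w : complexBetti P.X (2 * n)} (hw : w ∈ weilClassesOf P φ n d) {N : ℂ} (hcw : c = N • w) :
    N = 0 ∨ w = 0 := by
  subst hcw
  exact smul_eq_zero.mp
    (eq_zero_of_map_eq_pow_smul_of_mem_weilClassesOf hn hd hc (Submodule.smul_mem _ N hw))

/-! ### §2 Sheaf level: split designs with `K`-symmetric roots have `φ^* chᵢ = dⁱ·chᵢ` -/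

/-- Pull-back of a list sum of `t`-eigenclasses is `t` times the sum. [folklore] -/
theorem map_list_sum_eq_smul {k : ℕ} {t : ℂ} {M : Type*} (f : M → complexBetti P.X k) :
    ∀ (l : List M), (∀ L ∈ l, complexBetti.map φ.hom.hom.hom k (f L) = t • f L) →
      complexBetti.map φ.hom.hom.hom k (l.map f).sum = t • (l.map f).sum
  | [], _ => by rw [List.map_nil, List.sum_nil, map_zero, smul_zero]
  | L :: l, h => by
    rw [List.map_cons, List.sum_cons, map_add, smul_add, h L List.mem_cons_self,
      map_list_sum_eq_smul f l fun L' hL' ↦ h L' (List.mem_cons_of_mem L hL')]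

/-- **A rank-`≤ 1` sheaf with a `t`-eigen root**: `φ^* C.ch₁ L = t·C.ch₁ L` gives `φ^* C.chᵢ L = tⁱ·C.chᵢ L` for
`i ≥ 1` — the exponential `chᵢ(L) = ch₁(L)ⁱ/i!` on line bundles and §1. [cite: Fulton1998, §15.1 (iii)] -/
theorem ch_map_eq_pow_smul_of_hasRankLE_one (C : ChernCharacterBetti) {L : P.X.left.Modules}
    (hL : HasRankLE L 1) {t : ℂ} (hroot : complexBetti.map φ.hom.hom.hom 2 (C.ch P.X L 1) = t • C.ch P.X L 1)
    {i : ℕ} (hi : 0 < i) :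
    complexBetti.map φ.hom.hom.hom (2 * i) (C.ch P.X L i) = t ^ i • C.ch P.X L i := by
  rw [C.ch_of_hasRankLE_one hL hi, map_smul, map_cupPowTwo_eq_pow_smul_of_map_eq_smul hroot i, smul_comm]

/-- A split design `L₁ ⊞ (L₂ ⊞ (⋯ ⊞ Z))` of rank-`≤ 1` sheaves is finite locally free.
[cite: Hartshorne1977, II Ex. 5.7 (b)] -/
theorem isFiniteLocallyFree_foldr_biprod_of_hasRankLE_one {l : List P.X.left.Modules} {Z : P.X.left.Modules}
    (hZ : HasRankLE Z 1) (hl : ∀ L ∈ l, HasRankLE L 1) : IsFiniteLocallyFree (l.foldr (· ⊞ ·) Z) :=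
  isFiniteLocallyFree_foldr_biprod (isFiniteLocallyFree_of_isVectorBundle hZ.isVectorBundle) l
    fun L hL ↦ isFiniteLocallyFree_of_isVectorBundle (hl L hL).isVectorBundle

/-- **Split designs with `K`-symmetric (more generally `t`-eigen) roots**: for ANY `C : ChernCharacterBetti`, if
every root `C.ch₁ L` (`L ∈ Z :: l`, all of rank `≤ 1`) satisfies `φ^* C.ch₁ L = t·C.ch₁ L`, then
`φ^* C.chᵢ(L₁ ⊞ (L₂ ⊞ (⋯ ⊞ Z))) = tⁱ·C.chᵢ(⋯)` for every `i ≥ 1` (Whitney on `⊞`, `ch_foldr_biprod`, and the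
rank-one case). [cite: Fulton1998, Example 3.2.3 and §15.1 (iii)] -/
theorem ch_foldr_biprod_map_eq_pow_smul (C : ChernCharacterBetti) {l : List P.X.left.Modules}
    {Z : P.X.left.Modules} (hZ : HasRankLE Z 1) (hl : ∀ L ∈ l, HasRankLE L 1) {t : ℂ}
    (hroots : ∀ L ∈ Z :: l, complexBetti.map φ.hom.hom.hom 2 (C.ch P.X L 1) = t • C.ch P.X L 1)
    {i : ℕ} (hi : 0 < i) :
    complexBetti.map φ.hom.hom.hom (2 * i) (C.ch P.X (l.foldr (· ⊞ ·) Z) i) =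
      t ^ i • C.ch P.X (l.foldr (· ⊞ ·) Z) i := by
  have hlf : ∀ L ∈ l, IsFiniteLocallyFree L :=
    fun L hL ↦ isFiniteLocallyFree_of_isVectorBundle (hl L hL).isVectorBundle
  rw [C.ch_foldr_biprod (isFiniteLocallyFree_of_isVectorBundle hZ.isVectorBundle) i l hlf, map_add, smul_add,
    map_list_sum_eq_smul (fun L ↦ C.ch P.X L i) l fun L hL ↦
      ch_map_eq_pow_smul_of_hasRankLE_one C (hl L hL) (hroots L (List.mem_cons_of_mem Z hL)) hi,
    ch_map_eq_pow_smul_of_hasRankLE_one C hZ (hroots Z List.mem_cons_self) hi]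

/-! ### §3 The kernel-checked half (S4) of THEOREM S: `K`-symmetric split designs carry no odd-weight Weil class -/

/-- **THEOREM S, step (S4), unconditionally**: on a complex abelian variety `P` with `φ : P ⟶ P`, `d ≥ 1`, `n` ODD
(the rung: `n = 3`, `P` a `√−d` Weil sixfold such as the twisted CM square `E_ω³ × Ē_ω³`), for ANY Chern character
theory `C`, a split design `E₀ = L₁ ⊞ (L₂ ⊞ (⋯ ⊞ Z))` of rank-`≤ 1` sheaves ALL of whose roots are `K`-symmetric
(`φ^* C.ch₁ L = d·C.ch₁ L`) cannot have `C.chₙ(E₀) = N·w` with `N ≠ 0` and `w ≠ 0` in the Weil plane: `φ^*` acts by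
`dⁿ` on `C.chₙ(E₀)` (§2) and by `−dⁿ` on the Weil plane (§1). Equivalently: a split pure-Weil class design has a
root with non-zero `K`-antisymmetric component. (THEOREM S (S1)–(S3), workfile `SPLIT-SEEDS-DEAD-rung1-g0.md` §3,
says `I′`-semiregularity FORCES all roots `K`-symmetric — typed in §4.) [cite: vanGeemen1994HodgeAV, 4.9]
[cite: Fulton1998, §15.1 (iii)] -/
theorem splitDesign_KSymmetricRoots_weil_eq_zero (C : ChernCharacterBetti) {n d : ℕ} (hn : Odd n) (hd : 0 < d)
    {l : List P.X.left.Modules} {Z : P.X.left.Modules} (hZ : HasRankLE Z 1) (hl : ∀ L ∈ l, HasRankLE L 1)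
    (hroots : ∀ L ∈ Z :: l, complexBetti.map φ.hom.hom.hom 2 (C.ch P.X L 1) = (d : ℂ) • C.ch P.X L 1)
    {w : complexBetti P.X (2 * n)} (hw : w ∈ weilClassesOf P φ n d) {N : ℂ}
    (hch : C.ch P.X (l.foldr (· ⊞ ·) Z) n = N • w) : N = 0 ∨ w = 0 :=
  smul_eq_zero_of_map_eq_pow_smul_of_mem_weilClassesOf hn hd
    (ch_foldr_biprod_map_eq_pow_smul C hZ hl hroots hn.pos) hw hch

/-- Rational-coefficient form (the seed clause writes `((N : ℚ) : ℂ) • w`): `N ≠ 0` and `w ≠ 0` are incompatible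
with a `K`-symmetric-rooted split design of character `N·w` in odd degree `n`. [cite: vanGeemen1994HodgeAV, 4.9] -/
theorem splitDesign_KSymmetricRoots_not_seed (C : ChernCharacterBetti) {n d : ℕ} (hn : Odd n) (hd : 0 < d)
    {l : List P.X.left.Modules} {Z : P.X.left.Modules} (hZ : HasRankLE Z 1) (hl : ∀ L ∈ l, HasRankLE L 1)
    (hroots : ∀ L ∈ Z :: l, complexBetti.map φ.hom.hom.hom 2 (C.ch P.X L 1) = (d : ℂ) • C.ch P.X L 1)
    {w : complexBetti P.X (2 * n)} (hw : w ∈ weilClassesOf P φ n d) (hw0 : w ≠ 0) {N : ℚ} (hN : N ≠ 0)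
    (hch : C.ch P.X (l.foldr (· ⊞ ·) Z) n = ((N : ℚ) : ℂ) • w) : False := by
  rcases splitDesign_KSymmetricRoots_weil_eq_zero C hn hd hZ hl hroots hw hch with h | h
  · exact hN (by exact_mod_cast h)
  · exact hw0 h

/-! ### §4 The typed obstruction: granted THEOREM S (S1)–(S3), no split pure-Weil seed exists -/

/-- **No split pure-Weil semiregular seed, granted THEOREM S (S1)–(S3)** (sorry-free reduction; the binder `hS`
is spelled out, no named fact). SETTING: `P` a complex abelian variety with `φ : P ⟶ P`, `d ≥ 1`, `n` odd, `w ≠ 0`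
in the Weil plane `weilClassesOf P φ n d` (the rung: `n = 3`, `(P, φ) = (T × T, φ_T × (−φ_T))` a twisted square,
`φ_T² = −3`). BINDER `hS` = THEOREM S (S1)–(S3) of `SPLIT-SEEDS-DEAD-rung1-g0.md` §3 for this `(C, P, φ)`: a split
design `E₀ = L₁ ⊞ (⋯ ⊞ Z)` of rank-`≤ 1` sheaves which is `I′`-semiregular (`I′ = {q | q+1 ∈ I}`), whose
`C.chₙ` lies in the Weil plane and whose `C.chₚ` vanish for `p ∈ I ∖ {n}` (the pure-Weil design), has all roots
`K`-symmetric — pen-proved from `σ_q|_{Ext²(L_k,L_k)}(η·id) = ε_q c^q·η ∪ c₁(L_k)^q`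
[cite: BuchweitzFlenner2003, §4 Def. 4.1] [cite: Atiyah1957, Prop. 12], the test
vectors `x_κ = ⊕ₖ (κ⌟c₁(L_k))·id_{L_k} ∈ ⋂_{q∈I′} ker σ_q` for every `Φ`-equivariant first-order direction `κ`
[cite: VoisinHodgeI2002, §10.2.3] [cite: vanGeemen1994HodgeAV, Lemma 5.2], and the matrix lemma. CONCLUSION: the one-model pure-Weil seed
clause of the skeleton (`Theorems.forall_models_pureWeilSeed_iff_exists_on`, p814302) has NO witness of the
form `E₀ = l.foldr (· ⊞ ·) Z` with rank-`≤ 1` pieces. PROOF: `hS` makes the roots `K`-symmetric; §3.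
Honest scope: conditional on `hS`; silent on indecomposable `E₀`; not a statement about the rung's truth.
[cite: BuchweitzFlenner2003, §5 Thm. 5.1] [cite: vanGeemen1994HodgeAV, 4.9] -/
theorem not_exists_splitPureWeilSeedOn_of_theoremS (C : ChernCharacterBetti) {n d : ℕ} (hn : Odd n) (hd : 0 < d)
    {w : complexBetti P.X (2 * n)} (hw : w ∈ weilClassesOf P φ n d) (hw0 : w ≠ 0)
    (hS : ∀ (l : List P.X.left.Modules) (Z : P.X.left.Modules), HasRankLE Z 1 → (∀ L ∈ l, HasRankLE L 1) →
      ∀ (hE₀ : IsFiniteLocallyFree (l.foldr (· ⊞ ·) Z)) (I : Finset ℕ),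
        IsISemiregular hE₀ {q' | q' + 1 ∈ I} →
        C.ch P.X (l.foldr (· ⊞ ·) Z) n ∈ weilClassesOf P φ n d →
        (∀ p' ∈ I, p' ≠ n → C.ch P.X (l.foldr (· ⊞ ·) Z) p' = 0) →
        ∀ L ∈ Z :: l, complexBetti.map φ.hom.hom.hom 2 (C.ch P.X L 1) = (d : ℂ) • C.ch P.X L 1) :
    ¬ ∃ (I : Finset ℕ) (l : List P.X.left.Modules) (Z : P.X.left.Modules) (_ : HasRankLE Z 1)
        (_ : ∀ L ∈ l, HasRankLE L 1) (hE₀ : IsFiniteLocallyFree (l.foldr (· ⊞ ·) Z)) (N : ℚ),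
        n ∈ I ∧ N ≠ 0 ∧ IsISemiregular hE₀ {q' | q' + 1 ∈ I} ∧
        C.ch P.X (l.foldr (· ⊞ ·) Z) n = ((N : ℚ) : ℂ) • w ∧
        ∀ p' ∈ I, p' ≠ n → C.ch P.X (l.foldr (· ⊞ ·) Z) p' = 0 := by
  rintro ⟨I, l, Z, hZ, hl, hE₀, N, -, hN, hsr, hch, hchp⟩
  have hmem : C.ch P.X (l.foldr (· ⊞ ·) Z) n ∈ weilClassesOf P φ n d := by
    rw [hch]
    exact Submodule.smul_mem _ _ hw
  exact splitDesign_KSymmetricRoots_not_seed C hn hd hZ hl (hS l Z hZ hl hE₀ I hsr hmem hchp) hw hw0 hN hch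

/-- **The skeleton's every-model clause, split sub-population, is empty too** (granted `hS`): if on EVERY model
`X₀ ≅ P.X` the pure-Weil seed clause had a split witness, it would have one on `P.X` itself (model `Iso.refl`),
contradicting `not_exists_splitPureWeilSeedOn_of_theoremS`. For `n = 3` the every-model clause restricted to split
`E₀` is the split sub-case of the skeleton's `HasPureWeilSeedAt C P w`. [cite: BuchweitzFlenner2003, §5 Thm. 5.1] -/
theorem not_forall_models_splitPureWeilSeed_of_theoremS (C : ChernCharacterBetti) {n d : ℕ} (hn : Odd n)
    (hd : 0 < d) {w : complexBetti P.X (2 * n)} (hw : w ∈ weilClassesOf P φ n d) (hw0 : w ≠ 0)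
    (hS : ∀ (l : List P.X.left.Modules) (Z : P.X.left.Modules), HasRankLE Z 1 → (∀ L ∈ l, HasRankLE L 1) →
      ∀ (hE₀ : IsFiniteLocallyFree (l.foldr (· ⊞ ·) Z)) (I : Finset ℕ),
        IsISemiregular hE₀ {q' | q' + 1 ∈ I} →
        C.ch P.X (l.foldr (· ⊞ ·) Z) n ∈ weilClassesOf P φ n d →
        (∀ p' ∈ I, p' ≠ n → C.ch P.X (l.foldr (· ⊞ ·) Z) p' = 0) →
        ∀ L ∈ Z :: l, complexBetti.map φ.hom.hom.hom 2 (C.ch P.X L 1) = (d : ℂ) • C.ch P.X L 1) :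
    ¬ ∀ (X₀ : SchemeOver ℂ) (eX : P.X ≅ X₀), ∃ (I : Finset ℕ) (l : List X₀.left.Modules)
        (Z : X₀.left.Modules) (_ : HasRankLE Z 1) (_ : ∀ L ∈ l, HasRankLE L 1)
        (hE₀ : IsFiniteLocallyFree (l.foldr (· ⊞ ·) Z)) (N : ℚ),
        n ∈ I ∧ N ≠ 0 ∧ IsISemiregular hE₀ {q' | q' + 1 ∈ I} ∧
        complexBetti.map eX.hom (2 * n) (C.ch X₀ (l.foldr (· ⊞ ·) Z) n) = ((N : ℚ) : ℂ) • w ∧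
        ∀ p' ∈ I, p' ≠ n → C.ch X₀ (l.foldr (· ⊞ ·) Z) p' = 0 := by
  intro hall
  obtain ⟨I, l, Z, hZ, hl, hE₀, N, hnI, hN, hsr, hch, hchp⟩ := hall P.X (Iso.refl _)
  refine not_exists_splitPureWeilSeedOn_of_theoremS C hn hd hw hw0 hS
    ⟨I, l, Z, hZ, hl, hE₀, N, hnI, hN, hsr, ?_, hchp⟩
  have h' := hch
  simp only [Iso.refl_hom, complexBetti.map_id] at h'
  exact h'

/-! ### §5 The polarised (Kleiman) design `q·hⁿ + N·w` at a `K`-symmetric class `h` -/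

/-- **THEOREM S (S4) for the `h`-line design, unconditionally**: let `h ∈ H²(P(ℂ); ℂ)` be `K`-SYMMETRIC
(`φ^* h = d·h` — every `K`-compatible polarisation, Deligne (4.4); the route's `h = d·e^*a + φ^*e^*a`, since
`(φ^*)² = (−d·𝟙)^* = d²` on `H²`). A split design `E₀ = L₁ ⊞ (⋯ ⊞ Z)` of rank-`≤ 1` sheaves with `K`-symmetric
`C`-roots and `C.chₙ(E₀) = q·hⁿ + N·w`, `w` in the Weil plane, `n` odd, has `N = 0 ∨ w = 0`: `φ^*` multiplies
`C.chₙ(E₀)` (§2) and `hⁿ` (§1) by `dⁿ`, hence also `N·w = C.chₙ(E₀) − q·hⁿ`, and §1 applies. This is the degree-`n`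
clause of `HasWeilClassDesignAt C n P h w` / `HasBFSheafSeedAt C n P h w` (K2ᵀ, `stub_good`, every `d`, every
cell): their split sub-population with `K`-symmetric roots is empty as well. [cite: vanGeemen1994HodgeAV, 4.9]
[cite: Deligne1982HodgeCycles, §4 (4.4)] [cite: Fulton1998, Example 15.3.2] -/
theorem splitDesign_KSymmetricRoots_hLine_weil_eq_zero (C : ChernCharacterBetti) {n d : ℕ} (hn : Odd n)
    (hd : 0 < d) {l : List P.X.left.Modules} {Z : P.X.left.Modules} (hZ : HasRankLE Z 1)
    (hl : ∀ L ∈ l, HasRankLE L 1)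
    (hroots : ∀ L ∈ Z :: l, complexBetti.map φ.hom.hom.hom 2 (C.ch P.X L 1) = (d : ℂ) • C.ch P.X L 1)
    {h : complexBetti P.X 2} (hh : complexBetti.map φ.hom.hom.hom 2 h = (d : ℂ) • h)
    {w : complexBetti P.X (2 * n)} (hw : w ∈ weilClassesOf P φ n d) {q N : ℂ}
    (hch : C.ch P.X (l.foldr (· ⊞ ·) Z) n = q • cupPowTwo h n + N • w) : N = 0 ∨ w = 0 := by
  have hE := ch_foldr_biprod_map_eq_pow_smul C hZ hl hroots hn.pos
  have h1 : N • w = C.ch P.X (l.foldr (· ⊞ ·) Z) n - q • cupPowTwo h n := by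
    rw [hch, add_sub_cancel_left]
  have hc : complexBetti.map φ.hom.hom.hom (2 * n) (N • w) = ((d : ℂ) ^ n) • (N • w) := by
    rw [h1, map_sub, map_smul, hE, map_cupPowTwo_eq_pow_smul_of_map_eq_smul hh n, smul_sub, smul_comm q]
  exact smul_eq_zero_of_map_eq_pow_smul_of_mem_weilClassesOf hn hd hc hw rfl

/-- **No split Buchweitz–Flenner sheaf seed at a `K`-symmetric `h`, granted THEOREM S (S1)–(S3), polarised form**
(sorry-free reduction; binder spelled out). SETTING: `P`, `φ`, `d ≥ 1`, `n` odd, `h` `K`-symmetric, `w ≠ 0` in the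
Weil plane. BINDER `hS` = THEOREM S (S1)–(S3) of `SPLIT-SEEDS-DEAD-rung1-g0.md` §3 for `(C, P, φ, h)`: a split
design which is `I′`-semiregular, whose `C.chₚ` lie on the `h`-line for `p ∈ I ∖ {n}` and whose `C.chₙ` lies in
`ℂ·hⁿ ⊕ (Weil plane)` (the Kleiman design), has all roots `K`-symmetric — pen-proved with the `9`-dimensional
polarised Weil tangent space `T_W = {κ Φ-equivariant, κ⌟h = 0}` [cite: vanGeemen1994HodgeAV, Lemma 5.2]
[cite: VoisinHodgeI2002, §10.2.3] and `σ_q` on diagonal blocks [cite: BuchweitzFlenner2003, §4 Def. 4.1]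
[cite: Atiyah1957, Prop. 12]. CONCLUSION: the one-model clause of `HasBFSheafSeedAt C n P h w`
(`Theorems.hasBFSheafSeedAt_iff_exists_on`, p793733) has NO witness `E₀ = l.foldr (· ⊞ ·) Z` with rank-`≤ 1`
pieces: the split sub-population of `stub_good` / K2ᵀ at `K`-symmetric anchors `h(e, a)` is empty for every `d`.
Honest scope: conditional on `hS`; silent on indecomposable `E₀` and on the truth of K2ᵀ.
[cite: BuchweitzFlenner2003, §5 Thm. 5.1] [cite: Fulton1998, Example 15.3.2] -/
theorem not_exists_splitBFSheafSeedOn_of_theoremS (C : ChernCharacterBetti) {n d : ℕ} (hn : Odd n) (hd : 0 < d)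
    {h : complexBetti P.X 2} (hh : complexBetti.map φ.hom.hom.hom 2 h = (d : ℂ) • h)
    {w : complexBetti P.X (2 * n)} (hw : w ∈ weilClassesOf P φ n d) (hw0 : w ≠ 0)
    (hS : ∀ (l : List P.X.left.Modules) (Z : P.X.left.Modules), HasRankLE Z 1 → (∀ L ∈ l, HasRankLE L 1) →
      ∀ (hE₀ : IsFiniteLocallyFree (l.foldr (· ⊞ ·) Z)) (I : Finset ℕ),
        IsISemiregular hE₀ {q' | q' + 1 ∈ I} →
        (∃ (q : ℂ) (v : complexBetti P.X (2 * n)), v ∈ weilClassesOf P φ n d ∧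
          C.ch P.X (l.foldr (· ⊞ ·) Z) n = q • cupPowTwo h n + v) →
        (∀ p' ∈ I, p' ≠ n → ∃ c : ℂ, C.ch P.X (l.foldr (· ⊞ ·) Z) p' = c • cupPowTwo h p') →
        ∀ L ∈ Z :: l, complexBetti.map φ.hom.hom.hom 2 (C.ch P.X L 1) = (d : ℂ) • C.ch P.X L 1) :
    ¬ ∃ (I : Finset ℕ) (l : List P.X.left.Modules) (Z : P.X.left.Modules) (_ : HasRankLE Z 1)
        (_ : ∀ L ∈ l, HasRankLE L 1) (hE₀ : IsFiniteLocallyFree (l.foldr (· ⊞ ·) Z)) (q N : ℚ) (c : ℕ → ℚ),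
        n ∈ I ∧ N ≠ 0 ∧ IsISemiregular hE₀ {q' | q' + 1 ∈ I} ∧
        C.ch P.X (l.foldr (· ⊞ ·) Z) n = ((q : ℚ) : ℂ) • cupPowTwo h n + ((N : ℚ) : ℂ) • w ∧
        ∀ p' ∈ I, p' ≠ n → C.ch P.X (l.foldr (· ⊞ ·) Z) p' = ((c p' : ℚ) : ℂ) • cupPowTwo h p' := by
  rintro ⟨I, l, Z, hZ, hl, hE₀, q, N, c, -, hN, hsr, hch, hchp⟩
  have hroots := hS l Z hZ hl hE₀ I hsr ⟨((q : ℚ) : ℂ), ((N : ℚ) : ℂ) • w, Submodule.smul_mem _ _ hw, hch⟩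
    fun p' hp' hpn ↦ ⟨((c p' : ℚ) : ℂ), hchp p' hp' hpn⟩
  rcases splitDesign_KSymmetricRoots_hLine_weil_eq_zero C hn hd hZ hl hroots hh hw hch with h0 | h0
  · exact hN (by exact_mod_cast h0)
  · exact hw0 h0

/-! ### §6 Corollary: no power of a `K`-symmetric class lies in the Weil plane (`n` odd) -/

/-- **`K`-symmetric classes have no odd power in the Weil plane**: `φ^* h = d·h`, `n` odd, `d ≥ 1`, and
`a·hⁿ ∈ weilClassesOf P φ n d` force `a·hⁿ = 0` (`φ^*(a·hⁿ) = dⁿ·(a·hⁿ)`, §1). With the tree's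
`cupProduct_cupPowTwo_eq_zero_of_map_eq_smul_of_mem_weilClassesOf` (`hⁱ ⌣ w = 0`) this is the real-carrier form of
"`ℂ·hⁿ ∩ W_K = 0`" for a `K`-compatible polarisation — for `n = 3` exactly the last clause
`∀ a, a • cupPowTwo θ 3 ∈ weilClassesOf A φ 3 d → a • cupPowTwo θ 3 = 0` of the binder `h₄` of
`Theorems.HodgeAbelianVarieties.Negative.not_exists_weilSeeds_of_rigidity`, now DISCHARGED for `K`-symmetric `θ`.
[cite: vanGeemen1994HodgeAV, 4.9 and proof of Thm. 6.12] [cite: Deligne1982HodgeCycles, §4 (4.4)] -/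
theorem smul_cupPowTwo_eq_zero_of_map_eq_smul_of_mem_weilClassesOf {n d : ℕ} (hn : Odd n) (hd : 0 < d)
    {h : complexBetti P.X 2} (hh : complexBetti.map φ.hom.hom.hom 2 h = (d : ℂ) • h) (a : ℂ)
    (ha : a • cupPowTwo h n ∈ weilClassesOf P φ n d) : a • cupPowTwo h n = 0 :=
  eq_zero_of_map_eq_pow_smul_of_mem_weilClassesOf hn hd
    (by rw [map_smul, map_cupPowTwo_eq_pow_smul_of_map_eq_smul hh n, smul_comm]) ha

/-- The `n = 3` instance in the literal shape of that `h₄` clause (Weil sixfolds, the rung's degree): for a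
`K`-symmetric `θ` on `(P, φ)` with `d ≥ 1`, `∀ a, a·θ³ ∈ weilClassesOf P φ 3 d → a·θ³ = 0`.
[cite: vanGeemen1994HodgeAV, 4.9 and proof of Thm. 6.12] -/
theorem hLine_cube_meets_weilClassesOf_zero {d : ℕ} (hd : 0 < d) {θ : complexBetti P.X 2}
    (hθ : complexBetti.map φ.hom.hom.hom 2 θ = (d : ℂ) • θ) :
    ∀ a : ℂ, a • cupPowTwo θ 3 ∈ weilClassesOf P φ 3 d → a • cupPowTwo θ 3 = 0 :=
  fun a ha ↦ smul_cupPowTwo_eq_zero_of_map_eq_smul_of_mem_weilClassesOf ⟨1, rfl⟩ hd hθ a ha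

/-! ### §7 Line-filtered designs: the eigen-property is closed under extensions -/

/-- **Extensions preserve `φ^* chᵢ = tⁱ·chᵢ`**: for a short exact sequence `0 → E′ → E → E″ → 0` of vector bundles, if `φ^* C.chᵢ = tⁱ·C.chᵢ`
holds for `E′` and `E″` in every degree `i ≥ 1`, it holds for `E` (additivity `ch_shortExact`). With the rank-one case
`ch_map_eq_pow_smul_of_hasRankLE_one` this covers LINE-FILTERED designs (iterated extensions by rank-`≤ 1` sheaves with `K`-symmetric
roots — the populations of hodge-idea-1's THEOREM N′ (b), (d)), not only split ones: chain this lemma along the filtration.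
[cite: Fulton1998, Example 3.2.3 and §15.1 (iii)] -/
theorem ch_map_eq_pow_smul_of_shortExact (C : ChernCharacterBetti) {S : ShortComplex P.X.left.Modules} (hS : S.ShortExact)
    (h₁ : IsVectorBundle S.X₁) (h₃ : IsVectorBundle S.X₃) {t : ℂ}
    (hX₁ : ∀ i, 0 < i → complexBetti.map φ.hom.hom.hom (2 * i) (C.ch P.X S.X₁ i) = t ^ i • C.ch P.X S.X₁ i)
    (hX₃ : ∀ i, 0 < i → complexBetti.map φ.hom.hom.hom (2 * i) (C.ch P.X S.X₃ i) = t ^ i • C.ch P.X S.X₃ i)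
    {i : ℕ} (hi : 0 < i) :
    complexBetti.map φ.hom.hom.hom (2 * i) (C.ch P.X S.X₂ i) = t ^ i • C.ch P.X S.X₂ i := by
  rw [C.ch_shortExact S hS h₁ h₃ i, map_add, smul_add, hX₁ i hi, hX₃ i hi]

/-- **Any design with `φ^* chₙ = dⁿ·chₙ` carries no odd-weight Weil class** (split, line-filtered with `K`-symmetric roots, or otherwise):
`C.chₙ(E) = q·hⁿ + N·w` at a `K`-symmetric `h` with `w` in the Weil plane and `n` odd forces `N = 0 ∨ w = 0` (take `q = 0` for the
pure-Weil design). [cite: vanGeemen1994HodgeAV, 4.9] [cite: Fulton1998, Example 15.3.2] -/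
theorem design_eigen_hLine_weil_eq_zero (C : ChernCharacterBetti) {n d : ℕ} (hn : Odd n) (hd : 0 < d) {E : P.X.left.Modules}
    (hE : complexBetti.map φ.hom.hom.hom (2 * n) (C.ch P.X E n) = ((d : ℂ) ^ n) • C.ch P.X E n)
    {h : complexBetti P.X 2} (hh : complexBetti.map φ.hom.hom.hom 2 h = (d : ℂ) • h)
    {w : complexBetti P.X (2 * n)} (hw : w ∈ weilClassesOf P φ n d) {q N : ℂ}
    (hch : C.ch P.X E n = q • cupPowTwo h n + N • w) : N = 0 ∨ w = 0 := by
  have h1 : N • w = C.ch P.X E n - q • cupPowTwo h n := by rw [hch, add_sub_cancel_left]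
  have hc : complexBetti.map φ.hom.hom.hom (2 * n) (N • w) = ((d : ℂ) ^ n) • (N • w) := by
    rw [h1, map_sub, map_smul, hE, map_cupPowTwo_eq_pow_smul_of_map_eq_smul hh n, smul_sub, smul_comm q]
  exact smul_eq_zero_of_map_eq_pow_smul_of_mem_weilClassesOf hn hd hc hw rfl

end Summit.HodgeConjecture.HodgeConjecture.Theorems.TwistNormalisedKleimanSemiregularAnchor.Negative

end
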